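import Summits.MatrixMultiplication.MatrixMultiplication.Theorems.SaturationLadderTowerSchoenhage
import HarnessLib

/-!
# Saturation ladder — Kernel XXI: the uniform quarter ceiling of the Schönhage-pair squaring towers

Route `SaturationLadder` (deciding crux `h₁ = SubexpSaturation`, thin currency `ω(1,t,r) ≤ 1 + r`).
Kernel XVIII (`SaturationLadderTowerCeiling.schoenhagePairTower`) proved, for every Schönhage pair
`⟨1,l-1,1⟩ ⊕ ⟨e,1,l⟩` (`e, l ≥ 2`, isolated rank `r₀ = el + 1`), that all squaring stages are EXACT thin points
`ω_K(1, t_j, log l / log e) = 1 + log l / log e` over every field `K`, with `t₀ < t₁ < …` and the closed-form ceiling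

  `t_j < T(e,l) := log((e-1)(l-1)) / (el·log e) + λ₀ · log(el+1) / ((el+1)·el·log e)`,  `λ₀ = (el+1)²/((el+1)²-1)`.

Kernel XIX bounded the symmetric ceilings `T(n,n)` by Coppersmith's `α`.  THIS KERNEL closes the whole
two-parameter family at once (critic's offer K51-U):

* `pairCeiling_lt_quarter` — **`T(e,l) < 1/4` for all `e, l ≥ 2`**; hence (`schoenhagePairTower_lt_quarter`)
  every stage of every Schönhage-pair squaring tower has middle exponent `t_j < 1/4`.
* The bound is uniform and essentially sharp for the ceiling device: `T(2,4) = 49·log 3/(320·log 2) = 0.24269…`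
  (`pairCeiling_two_four`), the maximum of `T` over the family (numerically; `T(2,3) = 0.2349`, `T(2,5) = 0.2317`,
  `T(3,3) = 0.1637`, and `T → 0` along both parameters).

Reading for the census of `h₁` (which needs thin points with `t → 1`): the squaring-tower method on Schönhage
pairs is CAPPED BELOW `t = 1/4` — uniformly in the pair and in the depth — i.e. it never leaves rung 0 of the
ladder.  (The limit points `t_∞(e,l) = sup_j t_j ≤ T(e,l)` are treated in Kernel XXII.)

Proof.  With `N = el`, `L = log e`, `P = log((e-1)(l-1))`, `Q = log(N+1)` and `(N+1)²-1 = N(N+2)`,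
`T < 1/4 ⟺ 4N(N+2)P + 4(N+1)Q < N²(N+2)L` (`ceiling_lt_quarter_of`).  Four regimes:
(A) `e = 2`, `2 ≤ l ≤ 8`: seven integer certificates (`5³<2⁷`, `7<2³`, `3⁵<2⁸`, `11¹¹<2⁶⁰`, `13¹³<2⁴⁹`, `17<2⁵`);
(B) `e = 2`, `l ≥ 9`, (C) `e ≥ 3`, `l = 2`, (D) `e, l ≥ 3`: the tangent bounds `log x ≤ x/c + log c - 1`
(`c = 4, 8`), `log(e-1) < log e`, `log e > 1` for `e ≥ 3` (`exp 1 < 2.7182818286`), `0.6931471803 < log 2 < 0.6931471808`, and a cubic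
polynomial inequality in one variable (`nlinarith`).

Def-free, sorry-free; constants of record: `omegaRect`, `Real.log`.
-/

set_option linter.dupNamespace false

noncomputable section

open scoped BigOperators

namespace Summit.MatrixMultiplication.MatrixMultiplication.Theorems.SaturationLadderTowerQuarter

open Literature.Computability.AlgebraicComplexity
open Summit.MatrixMultiplication.MatrixMultiplication.Theorems.SaturationLadderTowerCeiling
open Summit.MatrixMultiplication.MatrixMultiplication.Theorems.SaturationLadderTowerSchoenhage

/-! ## §1 The master inequality and elementary logarithm bounds -/

/-- **Master step.**  With `(N+1)² - 1 = N(N+2)` the ceiling is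
`(4N(N+2)P + 4(N+1)Q) / (4N²(N+2)L)`, so a linear certificate gives `< 1/4`. -/
theorem ceiling_lt_quarter_of {N L P Q : ℝ} (hN : 0 < N) (hL : 0 < L)
    (h : 4 * N * (N + 2) * P + 4 * (N + 1) * Q < N ^ 2 * (N + 2) * L) :
    P / (N * L) + (N + 1) ^ 2 / ((N + 1) ^ 2 - 1) * (Q / ((N + 1) * (N * L))) < 1 / 4 := by
  have hN' : N ≠ 0 := hN.ne'
  have hL' : L ≠ 0 := hL.ne'
  have hN1 : N + 1 ≠ 0 := by positivity
  have hN2 : N + 2 ≠ 0 := by positivity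
  have hden : (N + 1) ^ 2 - 1 = N * (N + 2) := by ring
  rw [hden]
  have key : P / (N * L) + (N + 1) ^ 2 / (N * (N + 2)) * (Q / ((N + 1) * (N * L))) =
      (4 * N * (N + 2) * P + 4 * (N + 1) * Q) / (4 * (N ^ 2 * (N + 2) * L)) := by
    field_simp
  rw [key, div_lt_iff₀ (by positivity)]
  linarith

/-- Tangent bound of the concave logarithm at `c`: `log x ≤ x/c + log c - 1`. -/
theorem log_le_div_add_log_sub_one {x c : ℝ} (hx : 0 < x) (hc : 0 < c) :
    Real.log x ≤ x / c + Real.log c - 1 := by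
  have h := Real.log_le_sub_one_of_pos (div_pos hx hc)
  rw [Real.log_div hx.ne' hc.ne'] at h
  linarith

/-- Tangent at `8`: `log x ≤ x/8 + 3 log 2 - 1 < x/8 + 1.0794415424`. -/
theorem log_le_tangent_eight {x : ℝ} (hx : 0 < x) : Real.log x ≤ x / 8 + 1.0794415424 := by
  have h := log_le_div_add_log_sub_one hx (by norm_num : (0 : ℝ) < 8)
  have h8 : Real.log 8 = 3 * Real.log 2 := by
    rw [show (8 : ℝ) = 2 ^ 3 by norm_num, Real.log_pow]; push_cast; ring
  rw [h8] at h
  have h2 := Real.log_two_lt_d9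
  linarith

/-- Tangent at `4`: `log x ≤ x/4 + 2 log 2 - 1 < x/4 + 0.3862943616`. -/
theorem log_le_tangent_four {x : ℝ} (hx : 0 < x) : Real.log x ≤ x / 4 + 0.3862943616 := by
  have h := log_le_div_add_log_sub_one hx (by norm_num : (0 : ℝ) < 4)
  have h4 : Real.log 4 = 2 * Real.log 2 := by
    rw [show (4 : ℝ) = 2 ^ 2 by norm_num, Real.log_pow]; push_cast; ring
  rw [h4] at h
  have h2 := Real.log_two_lt_d9
  linarith

/-! ## §2 Integer certificates -/

/-- `7 < 8 = 2³`. -/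
theorem log_seven_lt : Real.log 7 < 3 * Real.log 2 := by
  have h := Real.log_lt_log (by norm_num : (0 : ℝ) < 7) (by norm_num : (7 : ℝ) < 2 ^ 3)
  rw [Real.log_pow] at h
  push_cast at h
  linarith

/-- `17 < 32 = 2⁵`. -/
theorem log_seventeen_lt : Real.log 17 < 5 * Real.log 2 := by
  have h := Real.log_lt_log (by norm_num : (0 : ℝ) < 17) (by norm_num : (17 : ℝ) < 2 ^ 5)
  rw [Real.log_pow] at h
  push_cast at h
  linarith

/-- `13¹³ = 302875106592253 < 562949953421312 = 2⁴⁹`. -/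
theorem thirteen_log_thirteen_lt : 13 * Real.log 13 < 49 * Real.log 2 := by
  have h := Real.log_lt_log (by norm_num : (0 : ℝ) < 13 ^ 13) (by norm_num : (13 : ℝ) ^ 13 < 2 ^ 49)
  rw [Real.log_pow, Real.log_pow] at h
  push_cast at h
  linarith

/-- `3⁴⁹ < 2⁸⁰` (`239299329230617529590083 < 1208925819614629174706176`). -/
theorem fortynine_log_three_lt : 49 * Real.log 3 < 80 * Real.log 2 := by
  have h := Real.log_lt_log (by norm_num : (0 : ℝ) < 3 ^ 49) (by norm_num : (3 : ℝ) ^ 49 < 2 ^ 80)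
  rw [Real.log_pow, Real.log_pow] at h
  push_cast at h
  linarith

/-- The cast of the base volume `(e-1)(l-1)`. -/
theorem cast_pred_mul_pred {e l : ℕ} (he : 1 ≤ e) (hl : 1 ≤ l) :
    (((e - 1) * (l - 1) : ℕ) : ℝ) = ((e : ℝ) - 1) * ((l : ℝ) - 1) := by
  rw [Nat.cast_mul, Nat.cast_sub he, Nat.cast_sub hl, Nat.cast_one]

/-! ## §3 The linear certificate `4N(N+2)P + 4(N+1)Q < N²(N+2)L` in the four regimes -/

/-- (A) `e = 2`, `2 ≤ l ≤ 8`: seven integer certificates. -/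
theorem cert_two_small {e l : ℕ} (he : e = 2) (hl : 2 ≤ l) (hl8 : l ≤ 8) :
    4 * ((e : ℝ) * l) * ((e : ℝ) * l + 2) * Real.log (((e - 1) * (l - 1) : ℕ) : ℝ) +
        4 * ((e : ℝ) * l + 1) * Real.log ((e : ℝ) * l + 1) <
      ((e : ℝ) * l) ^ 2 * ((e : ℝ) * l + 2) * Real.log e := by
  subst he
  rw [cast_pred_mul_pred (by norm_num) (by omega)]
  push_cast
  have h2 : 0 < Real.log 2 := Real.log_pos one_lt_two
  have c5 := three_log_five_lt
  have c3 := five_log_three_lt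
  have c11 := eleven_log_eleven_lt
  have c7 := log_seven_lt
  have c17 := log_seventeen_lt
  have c13 := thirteen_log_thirteen_lt
  have h4 : Real.log 4 = 2 * Real.log 2 := by
    rw [show (4 : ℝ) = 2 ^ 2 by norm_num, Real.log_pow]; push_cast; ring
  have h9 : Real.log 9 = 2 * Real.log 3 := by
    rw [show (9 : ℝ) = 3 ^ 2 by norm_num, Real.log_pow]; push_cast; ring
  have h6 : Real.log 6 = Real.log 2 + Real.log 3 := by
    rw [show (6 : ℝ) = 2 * 3 by norm_num, Real.log_mul (by norm_num) (by norm_num)]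
  have h15 : Real.log 15 = Real.log 3 + Real.log 5 := by
    rw [show (15 : ℝ) = 3 * 5 by norm_num, Real.log_mul (by norm_num) (by norm_num)]
  -- l = 2 : 20 log 5 < 96 log 2;  l = 3 : 192 log 2 + 28 log 7 < 288 log 2;  l = 4 : 320 log 3 + 36 log 9 < 640 log 2;
  -- l = 5 : 480 log 4 + 44 log 11 < 1200 log 2;  l = 6 : 672 log 5 + 52 log 13 < 2016 log 2;
  -- l = 7 : 896 log 6 + 60 log 15 < 3136 log 2;  l = 8 : 1152 log 7 + 68 log 17 < 4608 log 2.
  interval_cases l <;> norm_num <;> linarith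

/-- (B) `e = 2`, `l ≥ 9`: tangent bounds at `8` and a cubic in `l`. -/
theorem cert_two_large {e l : ℕ} (he : e = 2) (hl : 9 ≤ l) :
    4 * ((e : ℝ) * l) * ((e : ℝ) * l + 2) * Real.log (((e - 1) * (l - 1) : ℕ) : ℝ) +
        4 * ((e : ℝ) * l + 1) * Real.log ((e : ℝ) * l + 1) <
      ((e : ℝ) * l) ^ 2 * ((e : ℝ) * l + 2) * Real.log e := by
  subst he
  rw [cast_pred_mul_pred (by norm_num) (by omega)]
  push_cast
  rw [show ((2 : ℝ) - 1) * ((l : ℝ) - 1) = (l : ℝ) - 1 by ring]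
  have hl9 : (9 : ℝ) ≤ l := by exact_mod_cast hl
  have hl0 : (0 : ℝ) ≤ l := by positivity
  have h2lo := Real.log_two_gt_d9
  have hP : Real.log ((l : ℝ) - 1) ≤ ((l : ℝ) - 1) / 8 + 1.0794415424 := log_le_tangent_eight (by linarith)
  have hQ : Real.log (2 * (l : ℝ) + 1) ≤ (2 * (l : ℝ) + 1) / 8 + 1.0794415424 :=
    log_le_tangent_eight (by linarith)
  have f1 : 4 * (2 * (l : ℝ)) * (2 * (l : ℝ) + 2) * Real.log ((l : ℝ) - 1) ≤
      4 * (2 * (l : ℝ)) * (2 * (l : ℝ) + 2) * (((l : ℝ) - 1) / 8 + 1.0794415424) :=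
    mul_le_mul_of_nonneg_left hP (by positivity)
  have f2 : 4 * (2 * (l : ℝ) + 1) * Real.log (2 * (l : ℝ) + 1) ≤
      4 * (2 * (l : ℝ) + 1) * ((2 * (l : ℝ) + 1) / 8 + 1.0794415424) :=
    mul_le_mul_of_nonneg_left hQ (by positivity)
  have f3 : 0.6931471803 * ((2 * (l : ℝ)) ^ 2 * (2 * (l : ℝ) + 2)) ≤
      Real.log 2 * ((2 * (l : ℝ)) ^ 2 * (2 * (l : ℝ) + 2)) :=
    mul_le_mul_of_nonneg_right h2lo.le (by positivity)
  have poly : 4 * (2 * (l : ℝ)) * (2 * (l : ℝ) + 2) * (((l : ℝ) - 1) / 8 + 1.0794415424) +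
      4 * (2 * (l : ℝ) + 1) * ((2 * (l : ℝ) + 1) / 8 + 1.0794415424) <
      0.6931471803 * ((2 * (l : ℝ)) ^ 2 * (2 * (l : ℝ) + 2)) := by
    nlinarith [mul_nonneg (mul_nonneg (sub_nonneg.2 hl9) hl0) hl0, mul_nonneg (sub_nonneg.2 hl9) hl0,
      sub_nonneg.2 hl9]
  linarith

/-- (C) `e ≥ 3`, `l = 2`: `log(e-1) < log e`, `log e > 1`, tangent at `8`, a cubic in `e`. -/
theorem cert_large_two {e l : ℕ} (he : 3 ≤ e) (hl : l = 2) :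
    4 * ((e : ℝ) * l) * ((e : ℝ) * l + 2) * Real.log (((e - 1) * (l - 1) : ℕ) : ℝ) +
        4 * ((e : ℝ) * l + 1) * Real.log ((e : ℝ) * l + 1) <
      ((e : ℝ) * l) ^ 2 * ((e : ℝ) * l + 2) * Real.log e := by
  subst hl
  rw [cast_pred_mul_pred (by omega) (by norm_num)]
  push_cast
  have he3 : (3 : ℝ) ≤ e := by exact_mod_cast he
  have he0 : (0 : ℝ) ≤ e := by positivity
  have hL1 : 1 < Real.log (e : ℝ) := by
    rw [Real.lt_log_iff_exp_lt (by linarith)]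
    exact Real.exp_one_lt_d9.trans_le (by linarith)
  have hP : Real.log (((e : ℝ) - 1) * (2 - 1)) < Real.log e := by
    rw [show ((e : ℝ) - 1) * (2 - 1) = (e : ℝ) - 1 by ring]
    exact Real.log_lt_log (by linarith) (by linarith)
  have hQ : Real.log ((e : ℝ) * 2 + 1) ≤ ((e : ℝ) * 2 + 1) / 8 + 1.0794415424 :=
    log_le_tangent_eight (by linarith)
  have f1 : 4 * ((e : ℝ) * 2) * ((e : ℝ) * 2 + 2) * Real.log (((e : ℝ) - 1) * (2 - 1)) <
      4 * ((e : ℝ) * 2) * ((e : ℝ) * 2 + 2) * Real.log e :=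
    mul_lt_mul_of_pos_left hP (by positivity)
  have f2 : 4 * ((e : ℝ) * 2 + 1) * Real.log ((e : ℝ) * 2 + 1) ≤
      4 * ((e : ℝ) * 2 + 1) * (((e : ℝ) * 2 + 1) / 8 + 1.0794415424) :=
    mul_le_mul_of_nonneg_left hQ (by positivity)
  have hnn : (0 : ℝ) ≤ 8 * (e : ℝ) * (e + 1) * (e - 2) :=
    mul_nonneg (by positivity) (by linarith)
  have f3 : 1 * (8 * (e : ℝ) * (e + 1) * (e - 2)) ≤ Real.log e * (8 * (e : ℝ) * (e + 1) * (e - 2)) :=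
    mul_le_mul_of_nonneg_right hL1.le hnn
  have poly : 4 * ((e : ℝ) * 2 + 1) * (((e : ℝ) * 2 + 1) / 8 + 1.0794415424) <
      8 * (e : ℝ) * (e + 1) * (e - 2) := by
    nlinarith [mul_nonneg (mul_nonneg (sub_nonneg.2 he3) he0) he0, mul_nonneg (sub_nonneg.2 he3) he0,
      sub_nonneg.2 he3]
  linarith

/-- (D) `e ≥ 3`, `l ≥ 3`: `log((e-1)(l-1)) < log e + (l-1)/4 + 2 log 2 - 1`, `l ≤ N/3`, tangent at `8`
for `log(N+1)`, `log e > 1`, a cubic in `N = el ≥ 9`. -/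
theorem cert_large_large {e l : ℕ} (he : 3 ≤ e) (hl : 3 ≤ l) :
    4 * ((e : ℝ) * l) * ((e : ℝ) * l + 2) * Real.log (((e - 1) * (l - 1) : ℕ) : ℝ) +
        4 * ((e : ℝ) * l + 1) * Real.log ((e : ℝ) * l + 1) <
      ((e : ℝ) * l) ^ 2 * ((e : ℝ) * l + 2) * Real.log e := by
  rw [cast_pred_mul_pred (by omega) (by omega)]
  have he3 : (3 : ℝ) ≤ e := by exact_mod_cast he
  have hl3 : (3 : ℝ) ≤ l := by exact_mod_cast hl
  have hL1 : 1 < Real.log (e : ℝ) := by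
    rw [Real.lt_log_iff_exp_lt (by linarith)]
    exact Real.exp_one_lt_d9.trans_le (by linarith)
  have hPe : Real.log ((e : ℝ) - 1) < Real.log e := Real.log_lt_log (by linarith) (by linarith)
  have hPl : Real.log ((l : ℝ) - 1) ≤ ((l : ℝ) - 1) / 4 + 0.3862943616 := log_le_tangent_four (by linarith)
  have hP : Real.log (((e : ℝ) - 1) * ((l : ℝ) - 1)) < Real.log e + ((l : ℝ) / 4 + 0.1362943616) := by
    rw [Real.log_mul (by linarith) (by linarith)]
    linarith
  set N : ℝ := (e : ℝ) * l with hN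
  have hN9 : 9 ≤ N := by
    have := mul_le_mul he3 hl3 (by norm_num) (by linarith)
    linarith
  have hlN : 3 * (l : ℝ) ≤ N := by
    have := mul_le_mul_of_nonneg_right he3 (by linarith : (0 : ℝ) ≤ l)
    linarith
  have hN0 : 0 ≤ N := by linarith
  have hQ : Real.log (N + 1) ≤ (N + 1) / 8 + 1.0794415424 := log_le_tangent_eight (by linarith)
  have hc1 : 0 < 4 * N * (N + 2) := mul_pos (mul_pos (by norm_num) (by linarith)) (by linarith)
  have f1 : 4 * N * (N + 2) * Real.log (((e : ℝ) - 1) * ((l : ℝ) - 1)) <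
      4 * N * (N + 2) * (Real.log e + ((l : ℝ) / 4 + 0.1362943616)) :=
    mul_lt_mul_of_pos_left hP hc1
  have f2 : 4 * (N + 1) * Real.log (N + 1) ≤ 4 * (N + 1) * ((N + 1) / 8 + 1.0794415424) :=
    mul_le_mul_of_nonneg_left hQ (by linarith)
  have hnn : 0 ≤ N * (N + 2) * (N - 4) := mul_nonneg (mul_nonneg hN0 (by linarith)) (by linarith)
  have f3 : 1 * (N * (N + 2) * (N - 4)) ≤ Real.log e * (N * (N + 2) * (N - 4)) :=
    mul_le_mul_of_nonneg_right hL1.le hnn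
  have f4 : 4 * N * (N + 2) * (l : ℝ) ≤ 4 * N * (N + 2) * (N / 3) :=
    mul_le_mul_of_nonneg_left (by linarith) hc1.le
  have poly : 4 * N * (N + 2) * ((N / 3) / 4 + 0.1362943616) + 4 * (N + 1) * ((N + 1) / 8 + 1.0794415424) <
      N * (N + 2) * (N - 4) := by
    nlinarith [mul_nonneg (mul_nonneg (sub_nonneg.2 hN9) hN0) hN0, mul_nonneg (sub_nonneg.2 hN9) hN0,
      sub_nonneg.2 hN9]
  linarith

/-! ## §4 The uniform ceiling and the tower family -/

/-- **THE UNIFORM QUARTER CEILING.**  For every Schönhage pair `(e,l)`, `e, l ≥ 2`: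
`T(e,l) = log((e-1)(l-1))/(el log e) + λ₀ log(el+1)/((el+1) el log e) < 1/4`. -/
theorem pairCeiling_lt_quarter (e l : ℕ) (he : 2 ≤ e) (hl : 2 ≤ l) :
    Real.log (((e - 1) * (l - 1) : ℕ) : ℝ) / ((e : ℝ) * l * Real.log e) +
        ((e : ℝ) * l + 1) ^ 2 / (((e : ℝ) * l + 1) ^ 2 - 1) *
          (Real.log ((e : ℝ) * l + 1) / (((e : ℝ) * l + 1) * ((e : ℝ) * l * Real.log e))) < 1 / 4 := by
  have he1 : (1 : ℝ) < e := by exact_mod_cast he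
  have hl0 : (0 : ℝ) < l := by exact_mod_cast (show 0 < l by omega)
  have hN : (0 : ℝ) < (e : ℝ) * l := mul_pos (by linarith) hl0
  have hL : 0 < Real.log (e : ℝ) := Real.log_pos he1
  have hcert : 4 * ((e : ℝ) * l) * ((e : ℝ) * l + 2) * Real.log (((e - 1) * (l - 1) : ℕ) : ℝ) +
        4 * ((e : ℝ) * l + 1) * Real.log ((e : ℝ) * l + 1) <
      ((e : ℝ) * l) ^ 2 * ((e : ℝ) * l + 2) * Real.log e := by
    rcases Nat.lt_or_ge e 3 with he3 | he3
    · have he2 : e = 2 := by omega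
      rcases Nat.lt_or_ge l 9 with hl9 | hl9
      · exact cert_two_small he2 hl (by omega)
      · exact cert_two_large he2 hl9
    · rcases Nat.lt_or_ge l 3 with hl3 | hl3
      · exact cert_large_two he3 (by omega)
      · exact cert_large_large he3 hl3
  exact ceiling_lt_quarter_of hN hL hcert

/-- **The extremal ceiling** `T(2,4) = 49 log 3 / (320 log 2)` (`= 0.2426973…`), and it is `< 1/4` by `3⁴⁹ < 2⁸⁰`. -/
theorem pairCeiling_two_four :
    Real.log (((2 - 1) * (4 - 1) : ℕ) : ℝ) / ((2 : ℝ) * 4 * Real.log 2) +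
        ((2 : ℝ) * 4 + 1) ^ 2 / (((2 : ℝ) * 4 + 1) ^ 2 - 1) *
          (Real.log ((2 : ℝ) * 4 + 1) / (((2 : ℝ) * 4 + 1) * ((2 : ℝ) * 4 * Real.log 2))) =
      49 * Real.log 3 / (320 * Real.log 2) ∧
    49 * Real.log 3 / (320 * Real.log 2) < 1 / 4 := by
  have h2 : 0 < Real.log 2 := Real.log_pos one_lt_two
  have h9 : Real.log 9 = 2 * Real.log 3 := by
    rw [show (9 : ℝ) = 3 ^ 2 by norm_num, Real.log_pow]; push_cast; ring
  constructor
  · norm_num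
    rw [h9]
    field_simp
    ring
  · rw [div_lt_div_iff₀ (by positivity) (by norm_num)]
    have := fortynine_log_three_lt
    linarith

variable (K : Type) [Field K]

/-- **EVERY SQUARING STAGE OF EVERY SCHÖNHAGE PAIR HAS `t < 1/4`.**  For `e, l ≥ 2` the tower of Kernel XVIII
consists of exact thin points `ω_K(1, t_j, log l/log e) = 1 + log l/log e` (every field `K`) with
`t₀ < t₁ < … < 1/4`. -/
theorem schoenhagePairTower_lt_quarter (e l : ℕ) (he : 2 ≤ e) (hl : 2 ≤ l) :
    ∃ t : ℕ → ℝ,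
      t 0 = Real.log (((e - 1) * (l - 1) : ℕ) : ℝ) / ((e : ℝ) * l * Real.log e) ∧
      (∀ j, t j < t (j + 1)) ∧
      (∀ j, omegaRect K 1 (t j) (Real.log l / Real.log e) = 1 + Real.log l / Real.log e) ∧
      ∀ j, t j < 1 / 4 := by
  obtain ⟨t, r, A, ht0, -, -, -, -, hstep, hpt, -, hceil⟩ := schoenhagePairTower K e l he hl
  exact ⟨t, ht0, hstep, hpt, fun j => (hceil j).trans (pairCeiling_lt_quarter e l he hl)⟩

/-- Audit: the squaring-tower method on Schönhage pairs never produces a thin point with middle exponent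
`≥ 1/4`, in the precise sense that all its outputs lie in `{t < 1/4}`; the deciding crux `h₁` asks for thin
points with `t → 1`. -/
theorem schoenhagePairTower_capped (e l : ℕ) (he : 2 ≤ e) (hl : 2 ≤ l) :
    ∃ t : ℕ → ℝ, (∀ j, omegaRect K 1 (t j) (Real.log l / Real.log e) = 1 + Real.log l / Real.log e) ∧
      ∀ j, t j < 1 / 4 ∧ ¬ (1 / 4 : ℝ) ≤ t j := by
  obtain ⟨t, -, -, hpt, hq⟩ := schoenhagePairTower_lt_quarter K e l he hl
  exact ⟨t, hpt, fun j => ⟨hq j, not_le.2 (hq j)⟩⟩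

end Summit.MatrixMultiplication.MatrixMultiplication.Theorems.SaturationLadderTowerQuarter

end
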